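import Mathlib

/-!
# Isogeny-letter Hall capacity × PROPOSITION F — the arithmetic end of the g7 verdicts (hsemireg-alphabet-isogeny-1 g7)

Evidence file (typed, kernel-checked arithmetic only).  NOTHING here is proved toward HC / HC_CM / HC_AV / №4 / 26512 /
18881 / H2; CLASS ≠ DESIGN ≠ SHEAF ≠ SEED.

Context.  `propF` (cell file `lean/WeilLatticeLaw.lean` of this sub-folder, g2; pencil g1 §3): an INTEGRAL (A1)/(H1)-clean rank-4 class
with the Newton closure (R4) (`c₅ = c₆ = c₇ = c₈ = 0` in the clean algebra — automatic for the Chern character of a rank-4 VECTOR BUNDLE on the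
eightfold `P = (E_i × E_i)⁴`) has Weil coordinate `μ = 56 (x + y i)` with `5 ∣ x² + y²`, i.e. `μ ∈ 56(2+i)ℤ[i] ∪ 56(2−i)ℤ[i]`.
The g7 letter-room LPs (`code/letterlp.py`, exact dual certificates, logs `data/g7/letterlp-h{12,14}-recS2.log`) bound the Weil coordinate of every
(H1)-clean, relaxed-Hall-feasible TWO-TERM design `0 → P → N → E → 0` of rank 4 on the rooms
  R₁₄ = LINE-14 record cell alphabet (g11 S84, 2 833 cells) ∪ the 126 Mukai-simple (1+i)-letter classes (g5 S2), 191 G-orbit columns, and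
  R₁₂ = the same shifted to LINE-12,
by the support-function values quoted in the hypotheses below (each `≤` is `4·κ` for an exact LP dual with zero price on the size cap).
The two theorems say: the PROP-F lattice misses those polygons except at `μ = 0`.  Hence (pencil, one line): on R₁₄ and R₁₂ no rank-4 two-term
relaxed-Hall design has the Chern character of a vector bundle with `μ ≠ 0` — the «(R4) × κ» verdict of the g7 memo.  The LP values are DATA
(hypotheses), not kernel facts; only the lattice arithmetic is checked here.
-/

namespace HsemiregIsogeny1G7

/-- h = 14, room R₁₄: box `−72384/1403 ≤ Re μ ≤ 6552/115`, `−128 ≤ Im μ ≤ 1392/13` and the separating half-plane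
`29·Re μ − 57·Im μ ≤ 7296` (all certified LP support values at rank 4), against the PROP-F lattice `μ = 56(x + iy)`, `5 ∣ x² + y²`. -/
theorem propF_lattice_avoids_K4_h14 (x y : ℤ) (h5 : (5:ℤ) ∣ x ^ 2 + y ^ 2)
    (hre₁ : -72384 ≤ 1403 * (56 * x)) (hre₂ : 115 * (56 * x) ≤ 6552)
    (him₁ : -128 ≤ 56 * y) (him₂ : 13 * (56 * y) ≤ 1392)
    (hsep : 29 * (56 * x) - 57 * (56 * y) ≤ 7296) : x = 0 ∧ y = 0 := by
  have hx : 0 ≤ x ∧ x ≤ 1 := by constructor <;> omega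
  have hy : -2 ≤ y ∧ y ≤ 1 := by constructor <;> omega
  obtain ⟨hx0, hx1⟩ := hx
  obtain ⟨hy0, hy1⟩ := hy
  interval_cases x <;> interval_cases y <;> simp_all (config := {decide := true})

/-- h = 12, room R₁₂: box `−25344/509 ≤ Re μ ≤ 329472/5927`, `−128 ≤ Im μ ≤ 11232/119` (certified LP support values at rank 4):
no separating half-plane is needed, the box already misses the lattice. -/
theorem propF_lattice_avoids_K4_h12 (x y : ℤ) (h5 : (5:ℤ) ∣ x ^ 2 + y ^ 2)
    (hre₁ : -25344 ≤ 509 * (56 * x)) (hre₂ : 5927 * (56 * x) ≤ 329472)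
    (him₁ : -128 ≤ 56 * y) (him₂ : 119 * (56 * y) ≤ 11232) : x = 0 ∧ y = 0 := by
  have hx : x = 0 := by omega
  subst hx
  have hy : -2 ≤ y ∧ y ≤ 1 := by constructor <;> omega
  obtain ⟨hy0, hy1⟩ := hy
  interval_cases y <;> simp_all (config := {decide := true})

/-- g6's record CELL alphabet alone (h = 14; `κ₊ = 16`, `κ₋ = 32`, `Re μ` forced `0`; re-certified in g7 by an independent solver path):
box `Re μ = 0`, `−128 ≤ Im μ ≤ 64`.  The (R4) route to g6's «rank 4 ⇒ μ = 0» for vector-bundle cokernels, without the μ-quantum `q`. -/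
theorem propF_lattice_avoids_K4_record_cells (x y : ℤ) (h5 : (5:ℤ) ∣ x ^ 2 + y ^ 2)
    (hre : 56 * x = 0) (him₁ : -128 ≤ 56 * y) (him₂ : 56 * y ≤ 64) : x = 0 ∧ y = 0 := by
  have hx : x = 0 := by omega
  subst hx
  have hy : -2 ≤ y ∧ y ≤ 1 := by constructor <;> omega
  obtain ⟨hy0, hy1⟩ := hy
  interval_cases y <;> simp_all (config := {decide := true})

/-- The general shape used above, for the record: a convex polygon `K` (given by finitely many certified half-planes) and the PROP-F
lattice meet only in `0` as soon as every lattice point of the bounding box is cut off.  Stated as the trivial reduction it is. -/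
theorem lattice_point_excluded_of_halfplane (A B c px py : ℤ) (hK : ∀ u v : ℤ, (u, v) = (px, py) → A * u + B * v ≤ c)
    (hsep : c < A * px + B * py) : False := by
  have := hK px py rfl
  omega

end HsemiregIsogeny1G7
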